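import Mathlib
import HarnessLib

/-!
# `stub_abelDeficitOfSignedTail` of line `SketchIdeator2`: the Abel deficit bounded by SIGNED tails
(crux `LatticeLandauDamping.AbelThermodynamicLimit`, item stmt-AtomisticToContinuum-14013; `--supports` helper
file proving the registered abstract real-analysis stub `stub_abelDeficitOfSignedTail` of skeleton rev 14 and
closing nothing)

Content. For `c ∈ L¹(0,∞)` with `|c| ≤ C` on `(0,∞)` and SIGNED tails `|∫_{(t,∞)} c| ≤ B` for all `t ≥ τ`,
and `ν, τ > 0`:

  `|∫_{(0,∞)} (1 − e^{−νt}) c(t) dt| ≤ ν τ² C + 2B`.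

Proof. Split `(0,∞) = (0,τ] ∪ (τ,∞)` (`Set.Ioc_union_Ioi_eq_Ioi`, `MeasureTheory.setIntegral_union`).
* EARLY piece: `0 ≤ 1 − e^{−νt} ≤ νt` and `|c| ≤ C` give `‖∫_{(0,τ]} …‖ ≤ ντC · τ`
  (`MeasureTheory.norm_setIntegral_le_of_norm_le_const`), verbatim as in the sibling `abel_deficit_le` of
  `Cruxes/UniformAbelianRegularity/Lines/birth.lean`.
* LATE piece: with `w(t) = 1 − e^{−νt} = w(τ) + ∫_{(τ,t)} ν e^{−νs} ds`,
  `∫_{(τ,∞)} w c = w(τ) · ∫_{(τ,∞)} c + ∫_{(τ,∞)} ν e^{−νs} (∫_{(s,∞)} c) ds`, the second identity being Fubini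
  (`MeasureTheory.integral_integral_swap`) for the integrable kernel `1_{s<t} ν e^{−νs} c(t)` on `(τ,∞)²`
  (`MeasureTheory.Integrable.mul_prod` + `Integrable.indicator`, `measurableSet_lt`); no derivative of the tail
  function is needed (`c` is only integrable and bounded). Each term is `≤ B` in absolute value
  (`0 ≤ w(τ) ≤ 1`, `∫_{(τ,∞)} ν e^{−νs} ds = e^{−ντ} ≤ 1` from `integral_exp_mul_Ioi`), whence `2B`.

Mathlib only; no named fact is used; nothing here closes the item. [folklore]
-/

noncomputable section

open MeasureTheory Set Filter

namespace Summit.AtomisticToContinuum.FouriersLaw.Theorems.AbelThermodynamicLimit.SeriesLawAtEveryLaplaceFrequency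

/-- The exponential density `s ↦ ν e^{−νs}` (`ν > 0`) is integrable on every half-line `(a, ∞)`
(`integrableOn_exp_mul_Ioi`). [folklore] -/
theorem integrableOn_Ioi_const_mul_exp_neg_mul {ν : ℝ} (hν : 0 < ν) (a : ℝ) :
    IntegrableOn (fun s : ℝ => ν * Real.exp (-(ν * s))) (Ioi a) := by
  have h : IntegrableOn (fun s : ℝ => ν * Real.exp (-ν * s)) (Ioi a) :=
    Integrable.const_mul (integrableOn_exp_mul_Ioi (neg_neg_iff_pos.2 hν) a) ν
  simpa only [neg_mul] using h

/-- `∫_{(a,∞)} ν e^{−νs} ds = e^{−νa}` for `ν > 0` (`integral_exp_mul_Ioi`). [folklore] -/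
theorem integral_Ioi_const_mul_exp_neg_mul {ν : ℝ} (hν : 0 < ν) (a : ℝ) :
    ∫ s in Ioi a, ν * Real.exp (-(ν * s)) = Real.exp (-(ν * a)) := by
  have h := integral_exp_mul_Ioi (neg_neg_iff_pos.2 hν) a
  simp only [neg_mul] at h
  rw [integral_const_mul, h]
  field_simp

/-- `∫_{(τ,t)} ν e^{−νs} ds = e^{−ντ} − e^{−νt}` for `ν > 0`, `τ ≤ t` (difference of two half-line
integrals). [folklore] -/
theorem integral_Ioo_const_mul_exp_neg_mul {ν τ t : ℝ} (hν : 0 < ν) (hτt : τ ≤ t) :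
    ∫ s in Ioo τ t, ν * Real.exp (-(ν * s)) = Real.exp (-(ν * τ)) - Real.exp (-(ν * t)) := by
  have hint := integrableOn_Ioi_const_mul_exp_neg_mul hν τ
  have hsplit : ∫ s in Ioi τ, ν * Real.exp (-(ν * s)) =
      (∫ s in Ioc τ t, ν * Real.exp (-(ν * s))) + ∫ s in Ioi t, ν * Real.exp (-(ν * s)) := by
    rw [← Ioc_union_Ioi_eq_Ioi hτt]
    exact setIntegral_union (Ioc_disjoint_Ioi le_rfl) measurableSet_Ioi
      (hint.mono_set Ioc_subset_Ioi_self) (hint.mono_set (Ioi_subset_Ioi hτt))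
  have h1 := integral_Ioi_const_mul_exp_neg_mul hν τ
  have h2 := integral_Ioi_const_mul_exp_neg_mul hν t
  rw [← integral_Ioc_eq_integral_Ioo]
  linarith

/-- **Fubini on the wedge `τ < s < t`.** For `c` integrable on `(τ,∞)` and `ν > 0`,
`∫_{(τ,∞)} (e^{−ντ} − e^{−νt}) c(t) dt = ∫_{(τ,∞)} ν e^{−νs} (∫_{(s,∞)} c) ds`: both sides are the integral of
the integrable kernel `1_{s<t} ν e^{−νs} c(t)` over `(τ,∞) × (τ,∞)` (`MeasureTheory.integral_integral_swap`).
[folklore] -/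
theorem integral_Ioi_expWeight_mul_eq_integral_signedTail {c : ℝ → ℝ} {ν τ : ℝ} (hν : 0 < ν)
    (hint : IntegrableOn c (Ioi τ)) :
    ∫ t in Ioi τ, (Real.exp (-(ν * τ)) - Real.exp (-(ν * t))) * c t =
      ∫ s in Ioi τ, (ν * Real.exp (-(ν * s))) * ∫ t in Ioi s, c t := by
  -- the kernel on `(τ,∞) × (τ,∞)`, variables `p = (t, s)`
  obtain ⟨Φ, hΦ⟩ : ∃ Φ : ℝ × ℝ → ℝ,
      Φ = {p : ℝ × ℝ | p.2 < p.1}.indicator (fun p => c p.1 * (ν * Real.exp (-(ν * p.2)))) :=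
    ⟨_, rfl⟩
  have hk : IntegrableOn (fun s : ℝ => ν * Real.exp (-(ν * s))) (Ioi τ) :=
    integrableOn_Ioi_const_mul_exp_neg_mul hν τ
  have hΦint : Integrable Φ ((volume.restrict (Ioi τ)).prod (volume.restrict (Ioi τ))) := by
    rw [hΦ]
    exact (hint.mul_prod hk).indicator (measurableSet_lt measurable_snd measurable_fst)
  have hΦint' : Integrable (Function.uncurry fun t s => Φ (t, s))
      ((volume.restrict (Ioi τ)).prod (volume.restrict (Ioi τ))) := hΦint
  -- inner integral in `s` for fixed `t > τ`
  have hinner_t : EqOn (fun t => ∫ s in Ioi τ, Φ (t, s))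
      (fun t => (Real.exp (-(ν * τ)) - Real.exp (-(ν * t))) * c t) (Ioi τ) := by
    intro t ht
    have hΦt : (fun s => Φ (t, s)) = (Iio t).indicator fun s => c t * (ν * Real.exp (-(ν * s))) := by
      funext s
      simp only [hΦ, Set.indicator_apply, Set.mem_setOf_eq, Set.mem_Iio]
    show ∫ s in Ioi τ, Φ (t, s) = (Real.exp (-(ν * τ)) - Real.exp (-(ν * t))) * c t
    rw [hΦt, setIntegral_indicator measurableSet_Iio, Ioi_inter_Iio, integral_const_mul,
      integral_Ioo_const_mul_exp_neg_mul hν (le_of_lt ht), mul_comm]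
  -- inner integral in `t` for fixed `s > τ`
  have hinner_s : EqOn (fun s => ∫ t in Ioi τ, Φ (t, s))
      (fun s => (ν * Real.exp (-(ν * s))) * ∫ t in Ioi s, c t) (Ioi τ) := by
    intro s hs
    have hΦs : (fun t => Φ (t, s)) = (Ioi s).indicator fun t => c t * (ν * Real.exp (-(ν * s))) := by
      funext t
      simp only [hΦ, Set.indicator_apply, Set.mem_setOf_eq, Set.mem_Ioi]
    show ∫ t in Ioi τ, Φ (t, s) = (ν * Real.exp (-(ν * s))) * ∫ t in Ioi s, c t
    rw [hΦs, setIntegral_indicator measurableSet_Ioi, inter_eq_right.2 (Ioi_subset_Ioi (le_of_lt hs)),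
      integral_mul_const, mul_comm]
  calc ∫ t in Ioi τ, (Real.exp (-(ν * τ)) - Real.exp (-(ν * t))) * c t
        = ∫ t in Ioi τ, ∫ s in Ioi τ, Φ (t, s) := (setIntegral_congr_fun measurableSet_Ioi hinner_t).symm
    _ = ∫ s in Ioi τ, ∫ t in Ioi τ, Φ (t, s) := integral_integral_swap hΦint'
    _ = ∫ s in Ioi τ, (ν * Real.exp (-(ν * s))) * ∫ t in Ioi s, c t :=
          setIntegral_congr_fun measurableSet_Ioi hinner_s

/-- **Late piece of the Abel deficit, bounded by signed tails.** For `c` integrable on `(τ,∞)` (`τ ≥ 0`),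
`ν > 0` and `|∫_{(t,∞)} c| ≤ B` for all `t ≥ τ`: `|∫_{(τ,∞)} (1 − e^{−νt}) c(t) dt| ≤ 2B`, via
`∫_{(τ,∞)} (1 − e^{−νt}) c = (1 − e^{−ντ}) ∫_{(τ,∞)} c + ∫_{(τ,∞)} ν e^{−νs} (∫_{(s,∞)} c) ds` and
`∫_{(τ,∞)} ν e^{−νs} ds = e^{−ντ} ≤ 1`. [folklore] -/
theorem abs_integral_Ioi_abelWeight_mul_le_of_signedTail {c : ℝ → ℝ} {ν τ B : ℝ} (hν : 0 < ν)
    (hτ : 0 ≤ τ) (hint : IntegrableOn c (Ioi τ))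
    (htail : ∀ t : ℝ, τ ≤ t → |∫ s in Ioi t, c s| ≤ B) :
    |∫ t in Ioi τ, (1 - Real.exp (-(ν * t))) * c t| ≤ 2 * B := by
  have hB : 0 ≤ B := le_trans (abs_nonneg _) (htail τ le_rfl)
  have hexp_le : Real.exp (-(ν * τ)) ≤ 1 := Real.exp_le_one_iff.2 (by nlinarith)
  have hk : IntegrableOn (fun s : ℝ => ν * Real.exp (-(ν * s))) (Ioi τ) :=
    integrableOn_Ioi_const_mul_exp_neg_mul hν τ
  have hk0 : ∀ s : ℝ, 0 ≤ ν * Real.exp (-(ν * s)) := fun s => mul_nonneg hν.le (Real.exp_pos _).le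
  -- integrability of the pieces on `(τ, ∞)`
  have hcont : Continuous fun t : ℝ => 1 - Real.exp (-(ν * t)) := by fun_prop
  have hwc : IntegrableOn (fun t : ℝ => (1 - Real.exp (-(ν * t))) * c t) (Ioi τ) := by
    refine Integrable.mono hint (hcont.aestronglyMeasurable.mul hint.aestronglyMeasurable) ?_
    refine (ae_restrict_iff' measurableSet_Ioi).2 (Eventually.of_forall fun t ht => ?_)
    have ht0 : 0 ≤ ν * t := mul_nonneg hν.le (hτ.trans (le_of_lt ht))
    have h1 : Real.exp (-(ν * t)) ≤ 1 := Real.exp_le_one_iff.2 (by linarith)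
    have h2 := Real.exp_pos (-(ν * t))
    rw [norm_mul, Real.norm_eq_abs, abs_of_nonneg (by linarith)]
    exact mul_le_of_le_one_left (norm_nonneg _) (by linarith)
  have hconst : IntegrableOn (fun t : ℝ => (1 - Real.exp (-(ν * τ))) * c t) (Ioi τ) :=
    Integrable.const_mul hint _
  have hdiff : IntegrableOn (fun t : ℝ => (Real.exp (-(ν * τ)) - Real.exp (-(ν * t))) * c t) (Ioi τ) := by
    refine (Integrable.sub' hwc hconst).congr (Eventually.of_forall fun t => ?_)
    ring
  -- decomposition of the late integral
  have hpt : ∀ t : ℝ, (1 - Real.exp (-(ν * t))) * c t =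
      (1 - Real.exp (-(ν * τ))) * c t + (Real.exp (-(ν * τ)) - Real.exp (-(ν * t))) * c t :=
    fun t => by ring
  have hdecomp : ∫ t in Ioi τ, (1 - Real.exp (-(ν * t))) * c t =
      (1 - Real.exp (-(ν * τ))) * (∫ t in Ioi τ, c t) +
        ∫ t in Ioi τ, (Real.exp (-(ν * τ)) - Real.exp (-(ν * t))) * c t := by
    calc ∫ t in Ioi τ, (1 - Real.exp (-(ν * t))) * c t
          = ∫ t in Ioi τ, ((1 - Real.exp (-(ν * τ))) * c t
              + (Real.exp (-(ν * τ)) - Real.exp (-(ν * t))) * c t) :=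
            integral_congr_ae (Eventually.of_forall hpt)
      _ = (1 - Real.exp (-(ν * τ))) * (∫ t in Ioi τ, c t) +
            ∫ t in Ioi τ, (Real.exp (-(ν * τ)) - Real.exp (-(ν * t))) * c t := by
            rw [integral_add hconst hdiff, integral_const_mul]
  -- the boundary term `w(τ) · G(τ)`
  have hG : |(1 - Real.exp (-(ν * τ))) * ∫ t in Ioi τ, c t| ≤ B := by
    rw [abs_mul, abs_of_nonneg (by linarith)]
    calc (1 - Real.exp (-(ν * τ))) * |∫ t in Ioi τ, c t| ≤ 1 * B :=
          mul_le_mul (by linarith [Real.exp_pos (-(ν * τ))]) (htail τ le_rfl) (abs_nonneg _) zero_le_one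
      _ = B := one_mul B
  -- the Fubini term `∫ ν e^{−νs} G(s) ds`
  have hF : |∫ t in Ioi τ, (Real.exp (-(ν * τ)) - Real.exp (-(ν * t))) * c t| ≤ B := by
    rw [integral_Ioi_expWeight_mul_eq_integral_signedTail hν hint]
    have h1 : ‖∫ s in Ioi τ, (ν * Real.exp (-(ν * s))) * ∫ t in Ioi s, c t‖
        ≤ ∫ s in Ioi τ, B * (ν * Real.exp (-(ν * s))) := by
      refine norm_integral_le_of_norm_le (Integrable.const_mul hk B) ?_
      refine (ae_restrict_iff' measurableSet_Ioi).2 (Eventually.of_forall fun s hs => ?_)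
      rw [norm_mul, Real.norm_eq_abs, Real.norm_eq_abs, abs_of_nonneg (hk0 s), mul_comm]
      exact mul_le_mul_of_nonneg_right (htail s (le_of_lt hs)) (hk0 s)
    rw [integral_const_mul, integral_Ioi_const_mul_exp_neg_mul hν τ] at h1
    rw [← Real.norm_eq_abs]
    calc ‖∫ s in Ioi τ, (ν * Real.exp (-(ν * s))) * ∫ t in Ioi s, c t‖
          ≤ B * Real.exp (-(ν * τ)) := h1
      _ ≤ B * 1 := mul_le_mul_of_nonneg_left hexp_le hB
      _ = B := mul_one B
  rw [hdecomp, ← Real.norm_eq_abs]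
  calc ‖(1 - Real.exp (-(ν * τ))) * (∫ t in Ioi τ, c t) +
          ∫ t in Ioi τ, (Real.exp (-(ν * τ)) - Real.exp (-(ν * t))) * c t‖
        ≤ ‖(1 - Real.exp (-(ν * τ))) * ∫ t in Ioi τ, c t‖ +
            ‖∫ t in Ioi τ, (Real.exp (-(ν * τ)) - Real.exp (-(ν * t))) * c t‖ := norm_add_le _ _
    _ ≤ B + B := by
          rw [Real.norm_eq_abs, Real.norm_eq_abs]
          exact add_le_add hG hF
    _ = 2 * B := by ring

/-- **Registered stub `stub_abelDeficitOfSignedTail` of line `SketchIdeator2`** (abstract real analysis).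
If `c ∈ L¹(0,∞)`, `|c| ≤ C` on `(0,∞)` and the SIGNED tails satisfy `|∫_{(t,∞)} c| ≤ B` for all `t ≥ τ`,
then for `ν, τ > 0`: `|∫_{(0,∞)} (1 − e^{−νt}) c(t) dt| ≤ ν τ² C + 2B` — early piece `(0,τ]` via
`0 ≤ 1 − e^{−νt} ≤ νt` (as in `abel_deficit_le`), late piece `(τ,∞)` via
`abs_integral_Ioi_abelWeight_mul_le_of_signedTail` (Fubini on `τ < s < t`). [folklore] -/
theorem stub_abelDeficitOfSignedTail :
    ∀ (c : ℝ → ℝ) (ν τ C B : ℝ), 0 < ν → 0 < τ → 0 ≤ C → 0 ≤ B → MeasureTheory.IntegrableOn c (Set.Ioi 0) → (∀ t : ℝ, 0 < t → |c t| ≤ C) → (∀ t : ℝ, τ ≤ t → |∫ s in Set.Ioi t, c s| ≤ B) → |∫ t in Set.Ioi (0:ℝ), (1 - Real.exp (-(ν * t))) * c t| ≤ ν * τ ^ 2 * C + 2 * B := by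
  intro c ν τ C B hν hτ hC _hB hint hbound htail
  -- the weight `w(t) = 1 - e^{-νt}`: `0 ≤ w ≤ 1` and `w(t) ≤ νt` on `(0, ∞)`
  have hw0 : ∀ t : ℝ, 0 < t → 0 ≤ 1 - Real.exp (-(ν * t)) := fun t ht => by
    have h : Real.exp (-(ν * t)) ≤ 1 :=
      Real.exp_le_one_iff.2 (by nlinarith [mul_pos hν ht])
    linarith
  have hw1 : ∀ t : ℝ, 0 < t → 1 - Real.exp (-(ν * t)) ≤ 1 := fun t _ => by
    linarith [Real.exp_pos (-(ν * t))]
  have hwlin : ∀ t : ℝ, 0 < t → 1 - Real.exp (-(ν * t)) ≤ ν * t := fun t _ => by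
    linarith [Real.add_one_le_exp (-(ν * t))]
  -- integrability of the weighted function on `(0, ∞)`
  have hcont : Continuous fun t : ℝ => 1 - Real.exp (-(ν * t)) := by fun_prop
  have hf_int : IntegrableOn (fun t : ℝ => (1 - Real.exp (-(ν * t))) * c t) (Ioi 0) := by
    refine Integrable.mono hint (hcont.aestronglyMeasurable.mul hint.aestronglyMeasurable) ?_
    refine (ae_restrict_iff' measurableSet_Ioi).2 (Filter.Eventually.of_forall fun t ht => ?_)
    rw [norm_mul, Real.norm_eq_abs, abs_of_nonneg (hw0 t ht)]
    exact mul_le_of_le_one_left (norm_nonneg _) (hw1 t ht)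
  -- split `(0, ∞) = (0, τ] ∪ (τ, ∞)`
  have hsplit : ∫ t in Ioi (0:ℝ), (1 - Real.exp (-(ν * t))) * c t =
      (∫ t in Ioc (0:ℝ) τ, (1 - Real.exp (-(ν * t))) * c t) +
        ∫ t in Ioi τ, (1 - Real.exp (-(ν * t))) * c t := by
    rw [← Ioc_union_Ioi_eq_Ioi hτ.le]
    exact setIntegral_union (Ioc_disjoint_Ioi le_rfl) measurableSet_Ioi
      (hf_int.mono_set Ioc_subset_Ioi_self) (hf_int.mono_set (Ioi_subset_Ioi hτ.le))
  -- EARLY piece: `‖∫_{(0,τ]} w c‖ ≤ (ν τ C) · |(0, τ]| = ν τ² C`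
  have hearly : ‖∫ t in Ioc (0:ℝ) τ, (1 - Real.exp (-(ν * t))) * c t‖ ≤ ν * τ * C * τ := by
    have h := norm_setIntegral_le_of_norm_le_const (μ := (volume : Measure ℝ)) (s := Ioc (0:ℝ) τ)
      (f := fun t : ℝ => (1 - Real.exp (-(ν * t))) * c t) (C := ν * τ * C) measure_Ioc_lt_top
      (fun t ht => by
        rw [Real.norm_eq_abs, abs_mul, abs_of_nonneg (hw0 t ht.1)]
        calc (1 - Real.exp (-(ν * t))) * |c t| ≤ (ν * t) * C :=
              mul_le_mul (hwlin t ht.1) (hbound t ht.1) (abs_nonneg _) (by nlinarith [ht.1])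
          _ ≤ ν * τ * C := mul_le_mul_of_nonneg_right (mul_le_mul_of_nonneg_left ht.2 hν.le) hC)
    rwa [Real.volume_real_Ioc_of_le hτ.le, sub_zero] at h
  -- LATE piece: signed tails, `‖∫_{(τ,∞)} w c‖ ≤ 2B`
  have hlate : ‖∫ t in Ioi τ, (1 - Real.exp (-(ν * t))) * c t‖ ≤ 2 * B := by
    rw [Real.norm_eq_abs]
    exact abs_integral_Ioi_abelWeight_mul_le_of_signedTail hν hτ.le
      (hint.mono_set (Ioi_subset_Ioi hτ.le)) htail
  -- assemble
  rw [← Real.norm_eq_abs, hsplit]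
  calc ‖(∫ t in Ioc (0:ℝ) τ, (1 - Real.exp (-(ν * t))) * c t) + ∫ t in Ioi τ, (1 - Real.exp (-(ν * t))) * c t‖
        ≤ ‖∫ t in Ioc (0:ℝ) τ, (1 - Real.exp (-(ν * t))) * c t‖
            + ‖∫ t in Ioi τ, (1 - Real.exp (-(ν * t))) * c t‖ := norm_add_le _ _
    _ ≤ ν * τ * C * τ + 2 * B := add_le_add hearly hlate
    _ = ν * τ ^ 2 * C + 2 * B := by ring

end Summit.AtomisticToContinuum.FouriersLaw.Theorems.AbelThermodynamicLimit.SeriesLawAtEveryLaplaceFrequency
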